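import Summits.AtomisticToContinuum.BoseEinsteinCondensation.Theorems.LatticeODLROOffHalfFilling.Negative.SaturationBoundaryLemmas

/-!
# Crux `LatticeODLROOffHalfFilling` — the boundary point `|μ| = 3`: no ODLRO at saturation either

Crux-disprover results for `stmt-AtomisticToContinuum-11033` (route BECGroundStateSOS), part 3b
(parts 1, 2, 3a: `SaturationCertificate.lean`, `SaturationNoLRO.lean`,
`SaturationBoundaryLemmas.lean`), landed from `Cruxes/LatticeODLROOffHalfFilling/Disproof.lean`:

* `groundEnergy_hmu_three`, `bond_mulVec_eq_zero_of_mem` — at `μ = 3` the certificate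
  `hmu_decomp` has no `N↓` term: `E₀ = −3|Λ|/2` and the ground space of `H_{L,3}` is the common
  kernel of the bond squares `S⁺_x − S⁺_{x+eᵢ}`;
* `E_mulVec_eq_of_bonds` (walk along bonds, potential `tdist`), `E_mulVec_eq_smul_upVec`,
  `apply_single_eq`, `sumE_mulVec_eq` — `S⁺_x v = λ|⇑⟩` for every site with ONE amplitude
  `λ = v(x↓)`, so `S⁺_tot v = |Λ|λ|⇑⟩` (the ground space is `span{|⇑⟩, |q=0 magnon⟩}`);
* `card_mul_normSq_single_le`, `re_sum_hop_quad_le`, `re_gsf_sum_hop_le` —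
  `Re ω_{L,3}(Σ_{x,y}(S¹_xS¹_y + S²_xS²_y)) ≤ 3|Λ|/2`;
* `not_lroAt_three`, `not_lroAt_neg_three`, `abs_lt_three_of_lroAt` — **the ODLRO set of the
  crux's Hamiltonian family is contained in the open interval `(−3, 3)`**: `LROAt μ → |μ| < 3`
  (with `mu0_le_three` of part 2: the window `|μ| < μ₀` of any proof has `μ₀ ≤ 3`, and the
  boundary itself carries no order).
All [folklore].
-/

noncomputable section

namespace Summit.AtomisticToContinuum.BoseEinsteinCondensation.Theorems.LatticeODLROOffHalfFilling.Negative

open Literature.MathematicalPhysics.QuantumLattice Literature.Probability.LatticeModels Matrix Finset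
open scoped ComplexOrder BigOperators

section Boundary

variable (L : ℕ) [NeZero L]

/-- `E₀(H_{L,3}) = −3|Λ|/2` (`L ≥ 3`): the certificate `hmu_decomp` at `μ = 3` has no `N↓` term.
[folklore] -/
theorem groundEnergy_hmu_three (hL : 3 ≤ L) :
    (Hmu L 3).groundEnergy = -(3 * Fintype.card (TorusSite 3 L) / 2) := by
  refine le_antisymm (groundEnergy_hmu_le L hL 3) ?_
  have hH : (Hmu L 3).IsHermitian := Hmu_isHermitian L 3
  set ω := (Hmu L 3).groundStateFunctional with hω
  have hE : ω (Hmu L 3) = ((Hmu L 3).groundEnergy : ℂ) := groundStateFunctional_hamiltonian hH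
  have h1 : ω 1 = 1 := groundStateFunctional_one hH
  have hQ : ∀ (z : TorusSite 3 L) (i : Fin 3),
      0 ≤ (ω ((E z - E (z + Pi.single i 1))ᴴ * (E z - E (z + Pi.single i 1)))).re := fun z i =>
    (Complex.nonneg_iff.mp (groundStateFunctional_nonneg (Hmu L 3) _)).1
  have hdec := congrArg (fun A => (ω A).re) (hmu_decomp L hL 3)
  simp only [map_add, LinearMap.map_smul, map_sum, smul_eq_mul, h1, mul_one, Complex.add_re,
    Complex.re_ofReal_mul, Complex.re_sum, hE, Complex.ofReal_re] at hdec
  have hsumQ : 0 ≤ ∑ z : TorusSite 3 L, ∑ i : Fin 3,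
      (ω ((E z - E (z + Pi.single i 1))ᴴ * (E z - E (z + Pi.single i 1)))).re :=
    Finset.sum_nonneg fun z _ => Finset.sum_nonneg fun i _ => hQ z i
  nlinarith [hdec, hsumQ]

/-- **Kernel of the certificate at `μ = 3`**: every ground vector of `H_{L,3}` is killed by every
bond square, `(S⁺_x − S⁺_{x+eᵢ}) v = 0`. [folklore] -/
theorem bond_mulVec_eq_zero_of_mem (hL : 3 ≤ L) {v : TensorIndex (TorusSite 3 L) 2 → ℂ}
    (hv : v ∈ (Hmu L 3).groundSpace) (x : TorusSite 3 L) (i : Fin 3) :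
    (E x - E (x + Pi.single i 1)) *ᵥ v = 0 := by
  rw [mem_groundSpace_iff, groundEnergy_hmu_three L hL, hmu_decomp L hL 3, add_mulVec, add_mulVec,
    smul_mulVec, smul_mulVec, smul_mulVec, one_mulVec,
    show ((3 : ℝ) - 3 : ℝ) = 0 by norm_num, Complex.ofReal_zero, zero_smul, add_zero] at hv
  have h2 : ((1 / 2 : ℝ) : ℂ) • ((∑ z : TorusSite 3 L, ∑ j : Fin 3,
      (E z - E (z + Pi.single j 1))ᴴ * (E z - E (z + Pi.single j 1))) *ᵥ v) = 0 := by
    have := congrArg (fun w => w - (((-(3 * Fintype.card (TorusSite 3 L) / 2) : ℝ) : ℂ)) • v) hv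
    simpa using this
  have hhalf : ((1 / 2 : ℝ) : ℂ) ≠ 0 := by norm_num
  have hQv := (smul_eq_zero.mp h2).resolve_left hhalf
  have hquad : ∑ z : TorusSite 3 L, ∑ j : Fin 3,
      star ((E z - E (z + Pi.single j 1)) *ᵥ v) ⬝ᵥ ((E z - E (z + Pi.single j 1)) *ᵥ v) = 0 := by
    have := congrArg (fun w => star v ⬝ᵥ w) hQv
    simpa only [Matrix.sum_mulVec, dotProduct_sum, star_dotProduct_conjTranspose_mul_mulVec,
      dotProduct_zero] using this
  have hnn : ∀ (z : TorusSite 3 L) (j : Fin 3),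
      0 ≤ star ((E z - E (z + Pi.single j 1)) *ᵥ v) ⬝ᵥ ((E z - E (z + Pi.single j 1)) *ᵥ v) :=
    fun z j => dotProduct_star_self_nonneg _
  have hz := (Finset.sum_eq_zero_iff_of_nonneg (fun z _ => Finset.sum_nonneg fun j _ => hnn z j)).mp
    hquad x (Finset.mem_univ x)
  have hzi := (Finset.sum_eq_zero_iff_of_nonneg (fun j _ => hnn x j)).mp hz i (Finset.mem_univ i)
  exact dotProduct_star_self_eq_zero.mp hzi

/-- The coordinate "taxicab potential" `Σ_j val((b − a)_j)` used to walk `a` to `b` along bonds.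
[folklore] -/
def tdist (a b : TorusSite 3 L) : ℕ := ∑ j : Fin 3, ((b - a) j).val

omit [NeZero L] in
/-- `tdist a b = 0 → a = b`. [folklore] -/
theorem eq_of_tdist_eq_zero {a b : TorusSite 3 L} (h : tdist L a b = 0) : a = b := by
  unfold tdist at h
  have hj : ∀ j : Fin 3, ((b - a) j).val = 0 := fun j =>
    (Finset.sum_eq_zero_iff.mp h) j (Finset.mem_univ j)
  have : b - a = 0 := funext fun j => (ZMod.val_eq_zero _).mp (hj j)
  exact (sub_eq_zero.mp this).symm

/-- One step along `eᵢ` lowers the potential by one (`L ≥ 3`). [folklore] -/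
theorem tdist_step (hL : 3 ≤ L) {a b : TorusSite 3 L} {i : Fin 3} (hi : ((b - a) i).val ≠ 0) :
    tdist L (a + Pi.single i 1) b + 1 = tdist L a b := by
  haveI : Fact (1 < L) := ⟨by omega⟩
  unfold tdist
  have key : ∀ j : Fin 3, ((b - (a + Pi.single i 1) : TorusSite 3 L) j).val =
      if j = i then ((b - a) i).val - 1 else ((b - a) j).val := by
    intro j
    by_cases hji : j = i
    · subst hji
      rw [if_pos rfl, Pi.sub_apply, Pi.add_apply, Pi.single_eq_same, ← sub_sub,
        ZMod.val_sub (by rw [ZMod.val_one]; exact Nat.one_le_iff_ne_zero.mpr hi), ZMod.val_one]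
      rfl
    · rw [if_neg hji, Pi.sub_apply, Pi.add_apply, Pi.single_eq_of_ne hji, add_zero]
      rfl
  simp only [key]
  rw [← Finset.add_sum_erase _ _ (Finset.mem_univ i),
    ← Finset.add_sum_erase Finset.univ (fun j => ((b - a) j).val) (Finset.mem_univ i), if_pos rfl,
    Finset.sum_congr rfl fun j hj => if_neg (Finset.ne_of_mem_erase hj)]
  have h1 : 1 ≤ ((b - a) i).val := Nat.one_le_iff_ne_zero.mpr hi
  omega

/-- **Propagation along bonds**: if `S⁺_x v = S⁺_{x+eᵢ} v` for all directed bonds then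
`S⁺_a v = S⁺_b v` for ALL sites (the torus is connected). [folklore] -/
theorem E_mulVec_eq_of_bonds (hL : 3 ≤ L) {v : TensorIndex (TorusSite 3 L) 2 → ℂ}
    (hC : ∀ (x : TorusSite 3 L) (i : Fin 3), E x *ᵥ v = E (x + Pi.single i 1) *ᵥ v)
    (a b : TorusSite 3 L) : E a *ᵥ v = E b *ᵥ v := by
  suffices h : ∀ (K : ℕ) (a : TorusSite 3 L), tdist L a b = K → E a *ᵥ v = E b *ᵥ v from
    h _ a rfl
  intro K
  induction K with
  | zero => intro a h; rw [eq_of_tdist_eq_zero L h]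
  | succ K ih =>
    intro a h
    obtain ⟨i, hi⟩ : ∃ i : Fin 3, ((b - a) i).val ≠ 0 := by
      by_contra hcon
      push Not at hcon
      have : tdist L a b = 0 := Finset.sum_eq_zero fun j _ => hcon j
      omega
    rw [hC a i]
    apply ih
    have := tdist_step L hL hi
    omega

/-- **Structure of ground vectors at `μ = 3`**: `S⁺_x v = v(x↓) · |⇑⟩` for every site `x`, with
`x↓` the configuration with the single down spin at `x`. [folklore] -/
theorem E_mulVec_eq_smul_upVec (hL : 3 ≤ L) {v : TensorIndex (TorusSite 3 L) 2 → ℂ}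
    (hv : v ∈ (Hmu L 3).groundSpace) (x : TorusSite 3 L) :
    E x *ᵥ v = v (Function.update (fun _ => 0) x 1) • upVec := by
  have hC : ∀ (y : TorusSite 3 L) (i : Fin 3), E y *ᵥ v = E (y + Pi.single i 1) *ᵥ v := by
    intro y i
    have := bond_mulVec_eq_zero_of_mem L hL hv y i
    rwa [sub_mulVec, sub_eq_zero] at this
  have hall : ∀ y : TorusSite 3 L, E y *ᵥ v = E x *ᵥ v := fun y =>
    E_mulVec_eq_of_bonds L hL hC y x
  have hker : ∀ y : TorusSite 3 L, E y *ᵥ (E x *ᵥ v) = 0 := by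
    intro y
    by_cases hyx : y = x
    · subst hyx
      rw [mulVec_mulVec, E_mul_E, zero_mulVec]
    · rw [mulVec_mulVec, E, E, onSite_mul_onSite_comm hyx, ← E, ← E, ← mulVec_mulVec, hall y,
        mulVec_mulVec, E_mul_E, zero_mulVec]
  have key := eq_smul_upVec_of_forall_E_mulVec_eq_zero (E x *ᵥ v) hker
  rw [key, E_mulVec_apply, if_pos rfl]

/-- All single-down amplitudes of a ground vector agree. [folklore] -/
theorem apply_single_eq (hL : 3 ≤ L) {v : TensorIndex (TorusSite 3 L) 2 → ℂ}
    (hv : v ∈ (Hmu L 3).groundSpace) (x y : TorusSite 3 L) :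
    v (Function.update (fun _ => 0) x 1) = v (Function.update (fun _ => 0) y 1) := by
  have hC : ∀ (z : TorusSite 3 L) (i : Fin 3), E z *ᵥ v = E (z + Pi.single i 1) *ᵥ v := by
    intro z i
    have := bond_mulVec_eq_zero_of_mem L hL hv z i
    rwa [sub_mulVec, sub_eq_zero] at this
  have h := E_mulVec_eq_of_bonds L hL hC x y
  rw [E_mulVec_eq_smul_upVec L hL hv x, E_mulVec_eq_smul_upVec L hL hv y] at h
  have := congrFun h (fun _ => 0)
  simpa [upVec] using this

/-- **The total raising operator on a ground vector**: `S⁺_tot v = |Λ| v(x₀↓) · |⇑⟩`. [folklore] -/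
theorem sumE_mulVec_eq (hL : 3 ≤ L) {v : TensorIndex (TorusSite 3 L) 2 → ℂ}
    (hv : v ∈ (Hmu L 3).groundSpace) (x₀ : TorusSite 3 L) :
    (∑ x : TorusSite 3 L, E x) *ᵥ v =
      ((Fintype.card (TorusSite 3 L) : ℂ) * v (Function.update (fun _ => 0) x₀ 1)) • upVec := by
  rw [Matrix.sum_mulVec, Finset.sum_congr rfl fun x _ => E_mulVec_eq_smul_upVec L hL hv x,
    Finset.sum_congr rfl fun x _ => by rw [apply_single_eq L hL hv x x₀], Finset.sum_const,
    Finset.card_univ, ← Nat.cast_smul_eq_nsmul ℂ, smul_smul]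

/-- `|Λ| |v(x₀↓)|² ≤ ‖v‖²` (the single-down configurations are distinct). [folklore] -/
theorem card_mul_normSq_single_le (hL : 3 ≤ L) {v : TensorIndex (TorusSite 3 L) 2 → ℂ}
    (hv : v ∈ (Hmu L 3).groundSpace) (x₀ : TorusSite 3 L) :
    (Fintype.card (TorusSite 3 L) : ℝ) * Complex.normSq (v (Function.update (fun _ => 0) x₀ 1)) ≤
      (star v ⬝ᵥ v).re := by
  set single : TorusSite 3 L → TensorIndex (TorusSite 3 L) 2 := fun x => Function.update (fun _ => 0) x 1
    with hsingle
  have hinj : Function.Injective single := by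
    intro x y h
    by_contra hxy
    have := congrFun h x
    simp [hsingle, hxy] at this
  have hre : (star v ⬝ᵥ v).re = ∑ τ, Complex.normSq (v τ) := by
    simp only [dotProduct, Pi.star_apply, Complex.re_sum, Complex.star_def]
    refine Finset.sum_congr rfl fun τ _ => ?_
    rw [mul_comm, Complex.mul_conj, Complex.ofReal_re]
  rw [hre]
  calc (Fintype.card (TorusSite 3 L) : ℝ) * Complex.normSq (v (single x₀))
      = ∑ x : TorusSite 3 L, Complex.normSq (v (single x)) := by
        rw [Finset.sum_congr rfl fun x _ => by rw [apply_single_eq L hL hv x x₀], Finset.sum_const,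
          Finset.card_univ, nsmul_eq_mul]
    _ = ∑ τ ∈ Finset.univ.image single, Complex.normSq (v τ) := by
        rw [Finset.sum_image fun x _ y _ h => hinj h]
    _ ≤ ∑ τ, Complex.normSq (v τ) :=
        Finset.sum_le_sum_of_subset_of_nonneg (Finset.subset_univ _)
          fun τ _ _ => Complex.normSq_nonneg _

/-- **Quadratic-form bound on the ground space at `μ = 3`**:
`Re ⟨v, Σ_{x,y}(S¹_xS¹_y + S²_xS²_y) v⟩ ≤ (3|Λ|/2) ‖v‖²`. [folklore] -/
theorem re_sum_hop_quad_le (hL : 3 ≤ L) {v : TensorIndex (TorusSite 3 L) 2 → ℂ}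
    (hv : v ∈ (Hmu L 3).groundSpace) :
    (star v ⬝ᵥ (∑ x : TorusSite 3 L, ∑ y : TorusSite 3 L, hop x y) *ᵥ v).re ≤
      3 * (Fintype.card (TorusSite 3 L) : ℝ) / 2 * (star v ⬝ᵥ v).re := by
  obtain ⟨x₀⟩ : Nonempty (TorusSite 3 L) := inferInstance
  rw [sum_hop_eq, add_mulVec, dotProduct_add, Complex.add_re,
    star_dotProduct_conjTranspose_mul_mulVec, sumE_mulVec_eq L hL hv x₀]
  have h1 : (star ((((Fintype.card (TorusSite 3 L) : ℂ) * v (Function.update (fun _ => 0) x₀ 1)) •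
      (upVec : TensorIndex (TorusSite 3 L) 2 → ℂ))) ⬝ᵥ
      ((((Fintype.card (TorusSite 3 L) : ℂ) * v (Function.update (fun _ => 0) x₀ 1)) • upVec))).re =
      (Fintype.card (TorusSite 3 L) : ℝ) ^ 2 * Complex.normSq (v (Function.update (fun _ => 0) x₀ 1)) := by
    rw [star_smul, smul_dotProduct, dotProduct_smul, star_upVec_dotProduct_upVec, smul_eq_mul,
      smul_eq_mul, mul_one, Complex.star_def, mul_comm, Complex.mul_conj, Complex.ofReal_re,
      Complex.normSq_mul, Complex.normSq_natCast]
    ring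
  rw [h1]
  have h2 := card_mul_normSq_single_le L hL hv x₀
  have h3 := re_totalSpin_two_quad_le v
  have hcard : (0 : ℝ) ≤ Fintype.card (TorusSite 3 L) := Nat.cast_nonneg _
  nlinarith

/-- **`Re ω_{L,3}(Σ_{x,y}(S¹_xS¹_y + S²_xS²_y)) ≤ 3|Λ|/2`** (`L ≥ 3`): the tracial ground state at the
saturation field (ground space `span{|⇑⟩, |q=0 magnon⟩}`) has order parameter `O(|Λ|)`, not
`O(|Λ|²)`. [folklore] -/
theorem re_gsf_sum_hop_le (hL : 3 ≤ L) :
    ((Hmu L 3).groundStateFunctional (∑ x : TorusSite 3 L, ∑ y : TorusSite 3 L, hop x y)).re ≤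
      3 * (Fintype.card (TorusSite 3 L) : ℝ) / 2 := by
  have hH : (Hmu L 3).IsHermitian := Hmu_isHermitian L 3
  have key := re_gsf_nonneg_of_groundSpace (A := Hmu L 3)
    (T := ((3 * (Fintype.card (TorusSite 3 L) : ℝ) / 2 : ℝ) : ℂ) • 1 -
      ∑ x : TorusSite 3 L, ∑ y : TorusSite 3 L, hop x y) (fun v hv => by
    rw [sub_mulVec, smul_mulVec, one_mulVec, dotProduct_sub, dotProduct_smul, Complex.sub_re,
      smul_eq_mul, Complex.re_ofReal_mul]
    have := re_sum_hop_quad_le L hL hv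
    linarith)
  rw [map_sub, LinearMap.map_smul, groundStateFunctional_one hH, Complex.sub_re, smul_eq_mul,
    mul_one, Complex.ofReal_re] at key
  linarith

/-- **No ODLRO at the saturation field itself**: `¬ LROAt 3`. With `not_lroAt_of_three_lt`,
`lroAt_neg_iff` and `orderParam_nonneg` this pins the closed complement `|μ| ≥ 3` exactly: the
`k`-th liminf term at `μ = 3` lies in `[0, 3/(2(2k)³)]`. [folklore] -/
theorem not_lroAt_three : ¬ LROAt 3 := by
  intro h
  unfold LROAt at h
  obtain ⟨f, hf, hlo, hhi⟩ : ∃ f : ℕ → ℝ, 0 < Filter.liminf f Filter.atTop ∧ (∀ k, 0 ≤ f k) ∧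
      ∀ k : ℕ, 2 ≤ k → f k ≤ 3 / (2 * ((2 * k : ℕ) : ℝ) ^ 3) := by
    refine ⟨_, h, fun k => orderParam_nonneg 3 k, fun k hk => ?_⟩
    have hL0 : 2 * k ≠ 0 := by omega
    haveI : NeZero (2 * k) := ⟨hL0⟩
    have hL3 : 3 ≤ 2 * k := by omega
    have hcard : Fintype.card (TorusSite 3 (2 * k)) = (2 * k) ^ 3 := by
      simp [ZMod.card, Fintype.card_fin]
    simp only [torusPullback_apply, dif_neg hL0]
    rw [sum_sq_halfOpenBox_comp_torusProj (fun s t : TorusSite 3 (2 * k) =>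
      (∑ α : Fin 2, (Hmu (2 * k) 3).groundStateFunctional
        (siteSpin 1 s (Fin.castSucc α) * siteSpin 1 t (Fin.castSucc α))).re)]
    have hsum : (∑ s : TorusSite 3 (2 * k), ∑ t : TorusSite 3 (2 * k),
        (∑ α : Fin 2, (Hmu (2 * k) 3).groundStateFunctional
          (siteSpin 1 s (Fin.castSucc α) * siteSpin 1 t (Fin.castSucc α))).re) =
        ((Hmu (2 * k) 3).groundStateFunctional
          (∑ s : TorusSite 3 (2 * k), ∑ t : TorusSite 3 (2 * k), hop s t)).re := by
      simp only [map_sum, Complex.re_sum]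
      refine Finset.sum_congr rfl fun s _ => Finset.sum_congr rfl fun t _ => ?_
      rw [Fin.sum_univ_two, hop, map_add, Complex.add_re]
      rfl
    rw [hsum, card_halfOpenBox]
    have hb := re_gsf_sum_hop_le (2 * k) hL3
    rw [hcard] at hb
    push_cast at hb ⊢
    have hk : (0 : ℝ) < k := by exact_mod_cast (show 0 < k by omega)
    have hX : (0 : ℝ) < (2 * (k : ℝ)) ^ 3 := by positivity
    rw [div_le_div_iff₀ (by positivity) (by positivity)]
    nlinarith [hb, hX]
  have hlim : Filter.Tendsto (fun k : ℕ => 3 / (2 * ((2 * k : ℕ) : ℝ) ^ 3)) Filter.atTop (nhds 0) := by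
    have : Filter.Tendsto (fun k : ℕ => 2 * ((2 * k : ℕ) : ℝ) ^ 3) Filter.atTop Filter.atTop := by
      refine Filter.Tendsto.const_mul_atTop (by norm_num) ?_
      refine (Filter.tendsto_pow_atTop (by norm_num)).comp ?_
      exact tendsto_natCast_atTop_atTop.comp (Filter.tendsto_id.const_mul_atTop' (by norm_num))
    exact tendsto_const_nhds.div_atTop this
  have hlim' : Filter.Tendsto f Filter.atTop (nhds 0) :=
    tendsto_of_tendsto_of_tendsto_of_le_of_le' tendsto_const_nhds hlim
      (Filter.Eventually.of_forall hlo) ((Filter.eventually_ge_atTop 2).mono fun k hk => hhi k hk)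
  rw [hlim'.liminf_eq] at hf
  exact lt_irrefl 0 hf

/-- Likewise `¬ LROAt (−3)` (flip symmetry). [folklore] -/
theorem not_lroAt_neg_three : ¬ LROAt (-3) := by
  rw [lroAt_neg_iff]; exact not_lroAt_three

/-- **The ODLRO set is contained in the OPEN interval `(−3, 3)`**: `LROAt μ → |μ| < 3`.
[folklore] -/
theorem abs_lt_three_of_lroAt {μ : ℝ} (h : LROAt μ) : |μ| < 3 := by
  by_contra hcon
  push Not at hcon
  rcases hcon.lt_or_eq with hlt | heq
  · rcases lt_abs.mp hlt with h1 | h1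
    · exact not_lroAt_of_three_lt h1 h
    · exact not_lroAt_of_lt_neg_three (by linarith) h
  · rcases abs_eq (by norm_num : (0 : ℝ) ≤ 3) |>.mp heq.symm with rfl | rfl
    · exact not_lroAt_three h
    · exact not_lroAt_neg_three h

end Boundary

end Summit.AtomisticToContinuum.BoseEinsteinCondensation.Theorems.LatticeODLROOffHalfFilling.Negative
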